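import Mathlib
import HarnessLib
import Summits.ResolutionOfSingularities.ResolutionOfSingularities.Theorems.WildQuotientsWildQuotientResolutionS1aKillNecessity
import Summits.ResolutionOfSingularities.ResolutionOfSingularities.Theorems.WildQuotientsWildQuotientResolutionS1aWeightedReesRegular

/-!
# S1a — K-EXO: EVERY principal-centre kill is a `β̃ s^δ`-certificate kill (converse of KC1, valuation form)

[OURS · L1 W4.5c · lead-1 g11; plan-1 g14 K-LOC v1 §2 «K-EXO», ASSIGNMENT v10.28/v10.29 item (K1)] — NOT statements of the manuscript; counted 0;
AI-level work, weaker than expert review. Crux stmt-ResolutionOfSingularities-17941 `CyclicQuotientFourfolds`, line `s1a-logminvertex` v11, K-side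
(`stub_killTouchReachAux`). Route-independent; pure algebra on Włodarczyk's cobordant algebra `R^w = cobordantAlgebra f w`.

SETTING. `B` a domain, `f, w` a weighted centre with `f` weakly regular, positive weights and `B ⧸ (f)` a DOMAIN (then `R^w ⧸ (s) ≅ (B ⧸ (f))[X]`
is a domain, i.e. `s = t⁻¹` is a PRIME element of `R^w` — the one valuation used below is the `s`-order = the `𝒥`-order); `σ` a `𝒥`-adapted
automorphism of order dividing `p`; `β ∈ B`, `β ≠ 0`, with the boundary-admissibility (a′)_δ (`y ∈ 𝒥ₙ ⇒ σ y − y ∈ β 𝒥ₙ₊δ`) holding for `δ` and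
FAILING for `δ + 1` (the optimal shift; (a′)_δ ⟺ (H1)(β s^δ) by `admissible_iff_augmentationIdeal_le_span`).

* `isPrime_span_s` — `B ⧸ (f)` a domain ⇒ `(s)` is a prime ideal of `R^w` (`nonempty_cobordantAlgebra_quotient_s_equiv_of_isWeaklyRegular`);
* `mem_span_s_iff_of_coe_eq` — for `a ∈ 𝒥ₙ`: `a tⁿ ∈ (s) ⟺ a ∈ 𝒥ₙ₊₁` (exact order `n` = not divisible by `s`);
* ★★★ `augmentationIdeal_sigmaChart_eq_span_of_isPrincipal` — **K-EXO, chartwise**: on a σ-fixed chart `R_b = R^w[(bT^d)⁻¹]` (`d > 0`) on which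
  the augmentation ideal of `σʼ` is PRINCIPAL (the kill clause of `IsPrincipalCentreChart`) and `β b^k ∈ aug σ` for some `k` ((FD2): off `V(f)` the
  reduced fixed ideal `(aug σ : β)` is the unit ideal), `aug σʼ = (β s^δ) · R_b`. Proof: (H1) gives `aug σʼ = (g_b) ≤ (β s^δ)`, so `g_b = β s^δ x`;
  (FD2) gives `β s^{kd} ∈ aug σʼ`, so `x y = s^e`; if `s` is a unit of `R_b` we are done; otherwise `s` stays prime in the domain `R_b`, so
  `x = u s^i` (`mul_eq_mul_prime_pow`), and `i = 0` because the optimal increment `σ y₀ − y₀` (of exact `β`-reduced order `n₀ + δ`) would otherwise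
  acquire order `≥ n₀ + δ + 1` after multiplication by a power of the exact-order element `b` — impossible as `(s)` is prime;
* ★★ `cobordantKillCert_of_isPrincipal_cover` — **K-EXO**: if the kill clause holds on a σ-fixed degree-0 cover of `Spec R^w ∖ V(R₊)` (every
  `fᵢ t^{wᵢ}` nilpotent modulo the cover elements — `exists_normalised_cover`) and (FD2) holds for each cover element, then
  `CobordantKillCert f w σ … (β s^δ)`: (H1) from (a′)_δ, (H2) `(β s^δ) · R₊^N ≤ aug σ_R` by collecting the chartwise memberships.
So after dividing by the full fixed divisor `β̃` ((FD1) = (a′) for some shift, (FD2)), a principal-centre chart IS an irrelevant σ-admissible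
certificate kill chart and K-LEAST / K-U (`…S1aKillLeastRegular`) apply to it. No normality, S2 or divisor theory is used.
-/

set_option linter.dupNamespace false

noncomputable section

open Literature.AlgebraicGeometry.Resolution
open scoped LaurentPolynomial
open LaurentPolynomial
open Summit.ResolutionOfSingularities.ResolutionOfSingularities.Theorems.WildQuotientResolution.S1.CoarseChart

namespace Summit.ResolutionOfSingularities.ResolutionOfSingularities.Theorems.WildQuotientResolution.S1.KillCert

universe u v

variable {B : Type u} [CommRing B] {c : ℕ} (f : Fin c → B) (w : Fin c → ℕ)

/-! ## `s`-divisibility in `R^w` and the prime `(s)` -/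

/-- For `a ∈ 𝒥ₙ`, any element of `R^w` with underlying Laurent polynomial `a tⁿ` is divisible by `s` iff `a ∈ 𝒥ₙ₊₁`. [OURS · L1 W4.5c] -/
theorem mem_span_s_iff_of_coe_eq {n : ℕ} {a : B} (z : ↥(cobordantAlgebra f w)) (hz : (z : B[T;T⁻¹]) = C a * T (n : ℤ)) :
    z ∈ Ideal.span {cobordantAlgebra.s f w} ↔ a ∈ (weightedFiltration f w).ideal (n + 1) := by
  constructor
  · intro h
    obtain ⟨q, hq⟩ := Ideal.mem_span_singleton'.mp h
    have hcoe : (q : B[T;T⁻¹]) * T (-1) = C a * T (n : ℤ) := by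
      have := congrArg Subtype.val hq
      rw [MulMemClass.coe_mul, cobordantAlgebra.coe_s] at this
      rw [this, hz]
    have hl : ((q : B[T;T⁻¹]) * T (-1)).coeff (n : ℤ) = (q : B[T;T⁻¹]).coeff ((n + 1 : ℕ) : ℤ) := by
      have hidx : (n : ℤ) = ((n + 1 : ℕ) : ℤ) + (-1) := by push_cast; ring
      rw [show (T (-1) : B[T;T⁻¹]) = C 1 * T (-1) by rw [map_one, one_mul], ← single_eq_C_mul_T, hidx,
        AddMonoidAlgebra.coeff_mul_single_add, mul_one]
    have hr : (C a * T (n : ℤ)).coeff (n : ℤ) = a := by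
      rw [← single_eq_C_mul_T, AddMonoidAlgebra.coeff_single, Finsupp.single_eq_same]
    rw [← hr, ← hcoe, hl]
    exact coeff_mem_of_mem f w q (n + 1)
  · intro ha
    refine Ideal.mem_span_singleton'.mpr ⟨⟨C a * T ((n + 1 : ℕ) : ℤ), C_mul_T_mem_cobordantAlgebra f w ha⟩, Subtype.ext ?_⟩
    rw [MulMemClass.coe_mul, cobordantAlgebra.coe_s, hz, mul_assoc, ← T_add]
    congr 2
    push_cast; ring

/-- **`(s)` is prime in `R^w`** when `f` is weakly regular with positive weights and `B ⧸ (f)` is a domain (`R^w ⧸ (s) ≅ (B ⧸ (f))[X₁, …, X_c]`).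
[OURS · L1 W4.5c] -/
theorem isPrime_span_s [IsNoetherianRing B] (hw : ∀ i, 0 < w i) (hreg : RingTheory.Sequence.IsWeaklyRegular B (List.ofFn f))
    [IsDomain (B ⧸ Ideal.span (Set.range f))] : (Ideal.span {cobordantAlgebra.s f w}).IsPrime := by
  obtain ⟨e⟩ := nonempty_cobordantAlgebra_quotient_s_equiv_of_isWeaklyRegular f w hw hreg
  rw [← Ideal.Quotient.isDomain_iff_prime]
  exact e.toMulEquiv.isDomain

/-! ## The image of `aug σ` in `R^w` and the chart rings -/

section Chart

variable (σ : B ≃+* B)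
  (hσJ : ∀ n : ℕ, ((weightedFiltration f w).ideal n).map (σ : B →+* B) ≤ (weightedFiltration f w).ideal n)
  {p : ℕ} (hp : 0 < p) (hσp : ∀ x : B, (⇑σ)^[p] x = x)

/-- `aug σ · R^w ≤ aug σ_R` (the structure map intertwines `σ` and `σ_R`). [OURS · L1 W4.5c] -/
theorem map_augmentationIdeal_le :
    (augmentationIdeal σ).map (algebraMap B (↥(cobordantAlgebra f w))) ≤ augmentationIdeal (sigmaR σ f w hσJ hp hσp) := by
  rw [augmentationIdeal, Ideal.map_span, Ideal.span_le]
  rintro _ ⟨_, ⟨x, rfl⟩, rfl⟩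
  rw [map_sub, ← sigmaR_algebraMap σ f w hσJ hp hσp]
  exact sub_mem_augmentationIdeal _ _

/-- `b^k = (bT^d)^k · s^{kd}` in `R^w`. [folklore] -/
theorem algebraMap_pow_eq {ι : Type v} [AddCommGroup ι] [DecidableEq ι] (𝒜 : ι → AddSubgroup B) [GradedRing 𝒜] {d : ℕ}
    (b : ↥(𝒜 0)) (hb : b ∈ (traceFiltration 𝒜 f w).ideal d) (k : ℕ) :
    algebraMap B (↥(cobordantAlgebra f w)) ((b : B) ^ k) = coverElement 𝒜 f w d b hb ^ k * cobordantAlgebra.s f w ^ (k * d) := by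
  apply Subtype.ext
  rw [cobordantAlgebra.coe_algebraMap, MulMemClass.coe_mul, SubmonoidClass.coe_pow, coe_coverElement, cobordantAlgebra.coe_s_pow,
    mul_pow, ← map_pow, T_pow, mul_assoc, ← T_add]
  have : ((k : ℤ) * d + -((k * d : ℕ) : ℤ)) = 0 := by push_cast; ring
  rw [this, T_zero, mul_one]

/-- In a domain with a prime element `q`: `x y = q^e ⇒ x = u q^i` with `u` a unit. [folklore] -/
theorem exists_eq_unit_mul_pow_of_mul_eq_pow {D : Type*} [CommRing D] [IsDomain D] {q x y : D} (hq : Prime q) {e : ℕ}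
    (h : x * y = q ^ e) : ∃ (i : ℕ) (u : D), IsUnit u ∧ x = u * q ^ i := by
  obtain ⟨i, j, b', c', -, hbc, hx, -⟩ := mul_eq_mul_prime_pow hq (show x * y = 1 * q ^ e by rw [one_mul, h])
  exact ⟨i, b', IsUnit.of_mul_eq_one c' hbc.symm, hx⟩

/-- ★★★ **K-EXO, chartwise.** `B` a domain, `(s)` prime in `R^w`, `β ≠ 0`, (a′)_δ optimal (holds for `δ`, fails for `δ+1`); `b ∈ 𝒜 0 ∩ 𝒥_d` σ-fixed,
`d > 0`, with `β b^k ∈ aug σ` for some `k` ((FD2)) and the augmentation ideal of `σʼ` on `R^w[(bT^d)⁻¹]` PRINCIPAL (kill clause). Then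
`aug σʼ = (β s^δ) · R^w[(bT^d)⁻¹]`. [OURS · L1 W4.5c · K-LOC v1 §2; NOT a statement of the manuscript] -/
theorem augmentationIdeal_sigmaChart_eq_span_of_isPrincipal [IsDomain B] (hprime : (Ideal.span {cobordantAlgebra.s f w}).IsPrime)
    (β : B) (hβ : β ≠ 0) (δ : ℕ)
    (hadm : ∀ (n : ℕ) (y : B), y ∈ (weightedFiltration f w).ideal n →
      σ y - y ∈ Ideal.span {β} * (weightedFiltration f w).ideal (n + δ))
    (hopt : ∃ (n₀ : ℕ) (y₀ : B), y₀ ∈ (weightedFiltration f w).ideal n₀ ∧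
      σ y₀ - y₀ ∉ Ideal.span {β} * (weightedFiltration f w).ideal (n₀ + δ + 1))
    {ι : Type v} [AddCommGroup ι] [DecidableEq ι] (𝒜 : ι → AddSubgroup B) [GradedRing 𝒜] {d : ℕ} (hd : 0 < d) (b : ↥(𝒜 0))
    (hb : b ∈ (traceFiltration 𝒜 f w).ideal d) (hσb : σ (b : B) = b) (hFD2 : ∃ k : ℕ, β * (b : B) ^ k ∈ augmentationIdeal σ)
    (hprin : (augmentationIdeal (sigmaChart 𝒜 f w d b hb σ hσJ hp hσp hσb)).IsPrincipal) :
    augmentationIdeal (sigmaChart 𝒜 f w d b hb σ hσJ hp hσp hσb) =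
      Ideal.span {algebraMap (↥(cobordantAlgebra f w)) (ChartRing 𝒜 f w d b hb)
        (algebraMap B (↥(cobordantAlgebra f w)) β * cobordantAlgebra.s f w ^ δ)} := by
  classical
  -- notation
  set R := ↥(cobordantAlgebra f w) with hR
  set Rb := ChartRing 𝒜 f w d b hb
  set h : R := coverElement 𝒜 f w d b hb with hh
  set sR : R := cobordantAlgebra.s f w with hsR
  set g : R := algebraMap B R β * sR ^ δ with hg
  set φ : R →+* Rb := algebraMap R Rb with hφ
  set A : Ideal R := augmentationIdeal (sigmaR σ f w hσJ hp hσp) with hA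
  have haug : augmentationIdeal (sigmaChart 𝒜 f w d b hb σ hσJ hp hσp hσb) = A.map φ :=
    augmentationIdeal_sigmaChart_eq_map f w σ hσJ hp hσp 𝒜 b hb hσb
  -- (H1): `A ≤ (g)`, hence `aug σʼ ≤ (φ g)`
  have h1 : A ≤ Ideal.span {g} := augmentationIdeal_sigmaR_le_span_of_admissible_shift f w σ hσJ hp hσp δ β hadm
  have hle : A.map φ ≤ Ideal.span {φ g} := by
    refine (Ideal.map_mono h1).trans ?_
    rw [Ideal.map_span, Set.image_singleton]
  have hhU : IsUnit (φ h) := IsLocalization.Away.algebraMap_isUnit h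
  -- (FD2): `β s^{kd} ∈ A·Rb` for all large `k`
  have hFD2' : ∀ k : ℕ, (∃ k₀, k₀ ≤ k ∧ β * (b : B) ^ k₀ ∈ augmentationIdeal σ) → φ (algebraMap B R β * sR ^ (k * d)) ∈ A.map φ := by
    rintro k ⟨k₀, hk₀, hmem⟩
    have hmemk : β * (b : B) ^ k ∈ augmentationIdeal σ := by
      obtain ⟨j, rfl⟩ := Nat.exists_eq_add_of_le hk₀
      rw [pow_add, ← mul_assoc]
      exact Ideal.mul_mem_right _ _ hmem
    have hAR : algebraMap B R (β * (b : B) ^ k) ∈ A := map_augmentationIdeal_le f w σ hσJ hp hσp (Ideal.mem_map_of_mem _ hmemk)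
    rw [map_mul, algebraMap_pow_eq f w 𝒜 b hb k, ← hh, ← hsR] at hAR
    have hφA : φ (algebraMap B R β * (h ^ k * sR ^ (k * d))) ∈ A.map φ := Ideal.mem_map_of_mem φ hAR
    rw [show algebraMap B R β * (h ^ k * sR ^ (k * d)) = (algebraMap B R β * sR ^ (k * d)) * h ^ k by ring, map_mul, map_pow] at hφA
    exact (Ideal.mul_unit_mem_iff_mem _ (hhU.pow k)).mp hφA
  obtain ⟨k₀, hk₀⟩ := hFD2
  -- choose `k` with `δ ≤ k d`
  obtain ⟨k, hkk₀, hkδ⟩ : ∃ k, k₀ ≤ k ∧ δ ≤ k * d := ⟨k₀ + δ, by omega, by nlinarith⟩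
  have hβs : φ (algebraMap B R β * sR ^ (k * d)) ∈ A.map φ := hFD2' k ⟨k₀, hkk₀, hk₀⟩
  have hsplit : algebraMap B R β * sR ^ (k * d) = g * sR ^ (k * d - δ) := by
    rw [hg, mul_assoc, ← pow_add, Nat.add_sub_cancel' hkδ]
  rw [hsplit, map_mul, map_pow] at hβs
  apply le_antisymm
  · rw [haug]; exact hle
  rw [haug, Ideal.span_singleton_le_iff_mem]
  by_cases hsU : IsUnit (φ sR)
  · -- `s` a unit on the chart: `g · unit ∈ A·Rb`
    exact (Ideal.mul_unit_mem_iff_mem _ (hsU.pow _)).mp hβs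
  -- otherwise `s` stays prime in the domain `Rb`
  have hh0 : h ≠ 0 := by
    intro h0
    apply hsU
    haveI : Subsingleton Rb := by
      refine IsLocalization.subsingleton (M := Submonoid.powers h) (S := Rb) ?_
      rw [h0]; exact Submonoid.mem_powers_iff _ _ |>.mpr ⟨1, pow_one 0⟩
    exact isUnit_of_subsingleton _
  haveI : IsDomain Rb := Localization.Away.isDomain hh0
  have hinj : Function.Injective φ :=
    IsLocalization.injective Rb (powers_le_nonZeroDivisors_of_noZeroDivisors hh0)
  have hdisj : Disjoint ((Submonoid.powers h : Submonoid R) : Set R) ↑(Ideal.span {sR}) := by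
    rw [Set.disjoint_left]
    rintro _ ⟨m, rfl⟩ hm
    apply hsU
    obtain ⟨q, hq⟩ := Ideal.mem_span_singleton'.mp hm
    have : φ q * φ sR = φ h ^ m := by rw [← map_mul, hq, map_pow]
    exact isUnit_of_mul_isUnit_right (this ▸ hhU.pow m)
  have hprime' : (Ideal.span {φ sR}).IsPrime := by
    have := IsLocalization.isPrime_of_isPrime_disjoint (Submonoid.powers h) Rb _ hprime hdisj
    rwa [Ideal.map_span, Set.image_singleton] at this
  have hs0 : φ sR ≠ 0 := by
    rw [ne_eq, map_eq_zero_iff φ hinj]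
    exact nonZeroDivisors.ne_zero (cobordantAlgebra.s_mem_nonZeroDivisors f w)
  have hsprime : Prime (φ sR) := (Ideal.span_singleton_prime hs0).mp hprime'
  -- `g ≠ 0` in `R` and in `Rb`
  have hg0 : g ≠ 0 := by
    rw [hg]
    refine mul_ne_zero ?_ (pow_ne_zero _ (nonZeroDivisors.ne_zero (cobordantAlgebra.s_mem_nonZeroDivisors f w)))
    intro h0
    apply hβ
    have hc : (C β : B[T;T⁻¹]) = 0 := by
      have := congrArg Subtype.val h0
      rwa [cobordantAlgebra.coe_algebraMap, ZeroMemClass.coe_zero] at this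
    rw [← single_eq_C] at hc
    exact AddMonoidAlgebra.single_eq_zero.mp hc
  have hφg0 : φ g ≠ 0 := fun h0 => hg0 (hinj (by rw [h0, map_zero]))
  -- the principal generator `gb` of `aug σʼ = A·Rb`, a multiple of `φ g`
  obtain ⟨⟨gb, hgb⟩⟩ := hprin
  have hAgb : A.map φ = Ideal.span {gb} := by rw [← haug, hgb]
  obtain ⟨x, hx⟩ := Ideal.mem_span_singleton'.mp (hle (hAgb ▸ Ideal.mem_span_singleton_self gb))
  -- `x * y = s^e`
  obtain ⟨y, hy⟩ := Ideal.mem_span_singleton'.mp (hAgb ▸ hβs)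
  have hxy : x * y = φ sR ^ (k * d - δ) := by
    have h3 : φ g * (x * y) = φ g * φ sR ^ (k * d - δ) := by
      rw [← hy, ← hx]; ring
    exact mul_left_cancel₀ hφg0 h3
  obtain ⟨i, u, hu, hxu⟩ := exists_eq_unit_mul_pow_of_mul_eq_pow hsprime hxy
  -- so `A·Rb = (φ g · s^i)`
  have hAi : A.map φ = Ideal.span {φ g * φ sR ^ i} := by
    rw [hAgb, ← hx, hxu, show u * φ sR ^ i * φ g = u * (φ g * φ sR ^ i) by ring, Ideal.span_singleton_mul_left_unit hu]
  -- `i = 0` by optimality of `δ`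
  suffices hi : i = 0 by
    rw [hAi, hi, pow_zero, mul_one]; exact Ideal.mem_span_singleton_self _
  by_contra hi
  obtain ⟨i', rfl⟩ : ∃ i', i = i' + 1 := ⟨i - 1, by omega⟩
  obtain ⟨n₀, y₀, hy₀, hnot⟩ := hopt
  obtain ⟨t, ht, hyt⟩ := Ideal.mem_span_singleton_mul.mp (hadm n₀ y₀ hy₀)
  have htnot : t ∉ (weightedFiltration f w).ideal (n₀ + δ + 1) := fun ht' =>
    hnot (hyt ▸ Ideal.mul_mem_mul (Ideal.mem_span_singleton_self β) ht')
  let z₀ : R := ⟨C y₀ * T (n₀ : ℤ), C_mul_T_mem_cobordantAlgebra f w hy₀⟩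
  let z' : R := ⟨C t * T ((n₀ + δ : ℕ) : ℤ), C_mul_T_mem_cobordantAlgebra f w ht⟩
  have hinc : sigmaR σ f w hσJ hp hσp z₀ - z₀ = g * z' :=
    sigmaR_sub_eq_of_admissible_shift f w σ hσJ hp hσp δ β hyt.symm z₀ z' rfl rfl
  have hincA : sigmaR σ f w hσJ hp hσp z₀ - z₀ ∈ A := sub_mem_augmentationIdeal _ _
  -- `φ (g z') ∈ (g s)·Rb`
  have hmem : φ (g * z') ∈ (Ideal.span {g * sR}).map φ := by
    rw [← hinc]
    have h4 : φ (sigmaR σ f w hσJ hp hσp z₀ - z₀) ∈ A.map φ := Ideal.mem_map_of_mem φ hincA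
    rw [hAi, pow_succ', ← mul_assoc, ← map_mul φ g sR] at h4
    rw [Ideal.map_span, Set.image_singleton]
    obtain ⟨a, ha⟩ := Ideal.mem_span_singleton'.mp h4
    exact Ideal.mem_span_singleton'.mpr ⟨a * φ sR ^ i', by rw [← ha]; ring⟩
  obtain ⟨⟨⟨a, ha⟩, ⟨m, hm⟩⟩, hma⟩ := (IsLocalization.mem_map_algebraMap_iff (Submonoid.powers h) Rb).mp hmem
  simp only at hma
  have hR' : g * z' * m = a := hinj (by rw [map_mul, hma])
  obtain ⟨r, hr⟩ := Ideal.mem_span_singleton'.mp (hR' ▸ ha : g * z' * m ∈ Ideal.span {g * sR})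
  -- cancel `g`: `z' m = s r ∈ (s)`
  have hz'm : z' * m ∈ Ideal.span {sR} := by
    have h5 : g * (z' * m) = g * (sR * r) := by rw [← mul_assoc, ← hr]; ring
    rw [mul_left_cancel₀ hg0 h5]
    exact Ideal.mul_mem_right _ _ (Ideal.mem_span_singleton_self _)
  rcases hprime.mem_or_mem hz'm with hz' | hm'
  · exact htnot ((mem_span_s_iff_of_coe_eq f w z' rfl).mp hz')
  · exact Set.disjoint_left.mp hdisj hm hm'

/-- ★★ **K-EXO — the certificate.** Under the hypotheses of `augmentationIdeal_sigmaChart_eq_span_of_isPrincipal`, if the kill clause (principal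
augmentation ideal of `σʼ`) and (FD2) hold on a σ-fixed degree-0 COVER `(y_j T^{d̄})_j` of `Spec R^w ∖ V(R₊)` (every `fᵢ t^{wᵢ}` nilpotent modulo the
cover elements, as produced by `exists_normalised_cover`), then `β s^δ` is a COBORDANT KILL CERTIFICATE: (H1) `aug σ_R ≤ (β s^δ)` and
(H2) `(β s^δ) · R₊^N ≤ aug σ_R`. [OURS · L1 W4.5c · K-LOC v1 §2 K-EXO; NOT a statement of the manuscript] -/
theorem cobordantKillCert_of_isPrincipal_cover [IsDomain B] (hprime : (Ideal.span {cobordantAlgebra.s f w}).IsPrime)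
    (β : B) (hβ : β ≠ 0) (δ : ℕ)
    (hadm : ∀ (n : ℕ) (y : B), y ∈ (weightedFiltration f w).ideal n →
      σ y - y ∈ Ideal.span {β} * (weightedFiltration f w).ideal (n + δ))
    (hopt : ∃ (n₀ : ℕ) (y₀ : B), y₀ ∈ (weightedFiltration f w).ideal n₀ ∧
      σ y₀ - y₀ ∉ Ideal.span {β} * (weightedFiltration f w).ideal (n₀ + δ + 1))
    {ι : Type v} [AddCommGroup ι] [DecidableEq ι] (𝒜 : ι → AddSubgroup B) [GradedRing 𝒜] {dbar : ℕ} (hdbar : 0 < dbar) {L : ℕ}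
    (y : Fin L → ↥(𝒜 0)) (hy : ∀ j, y j ∈ (traceFiltration 𝒜 f w).ideal dbar) (hσy : ∀ j, σ (y j : B) = y j)
    (hcov : ∀ i : Fin c, cobordantAlgebra.u' f w i ∈ (Ideal.span (Set.range fun j => coverElement 𝒜 f w dbar (y j) (hy j))).radical)
    (hFD2 : ∀ j, ∃ k : ℕ, β * (y j : B) ^ k ∈ augmentationIdeal σ)
    (hprin : ∀ j, (augmentationIdeal (sigmaChart 𝒜 f w dbar (y j) (hy j) σ hσJ hp hσp (hσy j))).IsPrincipal) :
    CobordantKillCert f w σ hσJ hp hσp (algebraMap B (↥(cobordantAlgebra f w)) β * cobordantAlgebra.s f w ^ δ) := by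
  classical
  set R := ↥(cobordantAlgebra f w) with hR
  set g : R := algebraMap B R β * cobordantAlgebra.s f w ^ δ with hg
  set A : Ideal R := augmentationIdeal (sigmaR σ f w hσJ hp hσp) with hA
  refine ⟨augmentationIdeal_sigmaR_le_span_of_admissible_shift f w σ hσJ hp hσp δ β hadm, ?_⟩
  -- chartwise: `g · h_j^{n_j} ∈ A`
  have hchart : ∀ j, ∃ n : ℕ, g * coverElement 𝒜 f w dbar (y j) (hy j) ^ n ∈ A := by
    intro j
    set h : R := coverElement 𝒜 f w dbar (y j) (hy j) with hh
    by_cases hh0 : h = 0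
    · exact ⟨1, by rw [hh0, pow_one, mul_zero]; exact Ideal.zero_mem _⟩
    have heq := augmentationIdeal_sigmaChart_eq_span_of_isPrincipal f w σ hσJ hp hσp hprime β hβ δ hadm hopt 𝒜 hdbar (y j) (hy j)
      (hσy j) (hFD2 j) (hprin j)
    rw [augmentationIdeal_sigmaChart_eq_map f w σ hσJ hp hσp 𝒜 (y j) (hy j) (hσy j)] at heq
    have hmem : algebraMap R (ChartRing 𝒜 f w dbar (y j) (hy j)) g ∈
        A.map (algebraMap R (ChartRing 𝒜 f w dbar (y j) (hy j))) := by
      change algebraMap R _ g ∈ (augmentationIdeal (sigmaR σ f w hσJ hp hσp)).map _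
      rw [heq]; exact Ideal.mem_span_singleton_self _
    obtain ⟨⟨⟨a, ha⟩, ⟨m, hm⟩⟩, hma⟩ :=
      (IsLocalization.mem_map_algebraMap_iff (Submonoid.powers h) (ChartRing 𝒜 f w dbar (y j) (hy j))).mp hmem
    simp only at hma
    obtain ⟨n, rfl⟩ := (Submonoid.mem_powers_iff _ _).mp hm
    have hinj : Function.Injective (algebraMap R (ChartRing 𝒜 f w dbar (y j) (hy j))) :=
      IsLocalization.injective _ (powers_le_nonZeroDivisors_of_noZeroDivisors hh0)
    refine ⟨n, ?_⟩
    rw [show g * h ^ n = a from hinj (by rw [map_mul, hma])]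
    exact ha
  -- collect: `R₊ ≤ √(A : g)`
  let Q : Ideal R := A.colon (Ideal.span {g})
  have hQ : ∀ j, coverElement 𝒜 f w dbar (y j) (hy j) ∈ Q.radical := by
    intro j
    obtain ⟨n, hn⟩ := hchart j
    exact ⟨n, Ideal.mem_colon_span_singleton.mpr (by rw [mul_comm]; exact hn)⟩
  have hV : cobordantAlgebra.vertexIdeal f w ≤ Q.radical := by
    rw [cobordantAlgebra.vertexIdeal, Ideal.span_le]
    rintro _ ⟨i, rfl⟩
    refine (Ideal.radical_le_radical_iff.mpr ?_) (hcov i)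
    rw [Ideal.span_le]
    rintro _ ⟨j, rfl⟩
    exact hQ j
  obtain ⟨N, hN⟩ := Ideal.exists_pow_le_of_le_radical_of_fg hV (Submodule.fg_span (Set.finite_range _))
  refine ⟨N, Ideal.mul_le.mpr ?_⟩
  intro a ha x hx
  obtain ⟨r, rfl⟩ := Ideal.mem_span_singleton'.mp ha
  have hxg : x * g ∈ A := Ideal.mem_colon_span_singleton.mp (hN hx)
  rw [mul_assoc, mul_comm g x]
  exact Ideal.mul_mem_left _ _ hxg

end Chart

end Summit.ResolutionOfSingularities.ResolutionOfSingularities.Theorems.WildQuotientResolution.S1.KillCert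

end
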